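import Summits.AtomisticToContinuum.HydrodynamicLimit.Theorems.LambertianContactSwapLambertianEulerTimeLedgerFresh
import Summits.AtomisticToContinuum.HydrodynamicLimit.Theorems.LambertianContactSwapLambertianEulerTimeLedgerStopping
import Summits.AtomisticToContinuum.HydrodynamicLimit.Theorems.LambertianContactSwapLambertianEulerFwdGood
import Summits.AtomisticToContinuum.HydrodynamicLimit.Theorems.LambertianContactSwapLambertianEulerMomentLedgerChain
import Summits.AtomisticToContinuum.HydrodynamicLimit.Theorems.LambertianContactSwapLambertianEulerMarkov
import Summits.AtomisticToContinuum.HydrodynamicLimit.Theorems.LambertianContactSwapLambertianEulerPairPovzner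
import Summits.AtomisticToContinuum.HydrodynamicLimit.Theorems.LambertianContactSwapLambertianEulerPovzner
import Summits.AtomisticToContinuum.HydrodynamicLimit.Theorems.LambertianContactSwapLambertianEulerArchimedes
import Summits.AtomisticToContinuum.HydrodynamicLimit.Theorems.LambertianContactSwapLambertianEulerLambertLaw
import Literature.Analysis.FluidPDE.HardSphereAlexander
import HarnessLib

/-!
# The time ledger of the expected velocity moments along the Lambertian flow (part III)

Helper file (`--supports`) of the crux `LambertianEuler` of route `LambertianContactSwap`
(`AtomisticToContinuum/HydrodynamicLimit`, stmt-AtomisticToContinuum-11854), line `Sketch`: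
the registered sub-goal `timeLedgerLambda` (rung (T) of the tails memo) of the stub
`stub_tailsLambda : LambertPairPovzner → TailsLambda` (Bobylev's Gaussian-moment ladder along the
Lambertian flow `Λ`).

The landed collision-indexed ledger `momentLedger_chain`
(`…LambertianContactSwapLambertianEulerMomentLedgerChain`) bounds the expected `2k`-th velocity
moment `M_{2k} = ∑ᵢ ‖vᵢ‖^{2k}` after the `m`-th collision of the recursion
`z_m = lambertStateAfter` by its value before plus the expected guarded pair-Povzner increment at
`z_m`. Here the ledger is re-indexed by TIME: for an initial probability law `P ≪ liouville` of
the datum, `0 < ε < 1/2`, `s ≤ s'`, and under the integrability of `(K_{s'} + 1) (∑ᵢ ‖vᵢ‖²)^k`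
(`K = lambertCount`),

`E[M_{2k}(Λ_{s'})] ≤ E[M_{2k}(Λ_s)] + E[∑_{m < K_{s'}} 1_{s < t_{m+1}} increment_k(z_m)]`

(`timeLedgerLambda`; expectations under `P ⊗ γ^ℕ`). Assembly of

* part I `…TimeLedgerFresh` (`integral_indicator_stateAfter_succ_le`: weighted transport of a
  one-step conditional ledger over the fresh `m`-th redraw, under `P ⊗ γ^ℕ`),
* part II `…TimeLedgerStopping` (`integral_flow_le_of_windowed_ledger`: optional stopping over the
  collision index — telescoping over the window events `{s < t_{m+1} ≤ s'}` and dominated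
  convergence),
* the one-step ledger `integral_moment_lambertStep_le_increment` of `…MomentLedgerChain` with the
  pair Povzner bound of the cosine redraw, PROVED on the line
  (`lambertPairPovzner_of_lambertPovzner`, `lambertPovzner_of_archimedes_of_lambertLaw`,
  `archimedesV3`, `lambertLaw`),
* the a.e. forward regularity of `Λ` (`lambert_ae_fwdGood` of `…LambertianEulerFwdGood`: simple
  incoming exits and unbounded instants, `liouville ⊗ γ^ℕ`-a.e., transferred to `P ⊗ γ^ℕ` by
  `P ≪ liouville`),

with the envelope `C (∑ᵢ ‖vᵢ‖²)^k` of the moments and increments along the recursion (the kinetic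
energy never increases). All [folklore]; no definitions, no named facts.
-/

noncomputable section

open scoped BigOperators Topology ENNReal InnerProductSpace
open MeasureTheory ProbabilityTheory Filter Set
open Literature.MathematicalPhysics.KineticTheory
open Literature.Analysis.FluidPDE Literature.Analysis.FluidPDE.Alexander

namespace Summit.AtomisticToContinuum.HydrodynamicLimit.Theorems.LambertianContactSwapLambertianEulerTimeLedger

open Summit.AtomisticToContinuum.HydrodynamicLimit.Theorems.LambertianContactSwapLambertianEulerMomentLedger
  Summit.AtomisticToContinuum.HydrodynamicLimit.Theorems.LambertianContactSwapLambertianEulerMomentLedgerChain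
  Summit.AtomisticToContinuum.HydrodynamicLimit.Theorems.LambertianContactSwapLambertianEulerMarkov
  Summit.AtomisticToContinuum.HydrodynamicLimit.Theorems.LambertianContactSwapLambertianEulerPairPovzner
  Summit.AtomisticToContinuum.HydrodynamicLimit.Theorems.LambertianContactSwapLambertianEulerPovzner
  Summit.AtomisticToContinuum.HydrodynamicLimit.Theorems.LambertianContactSwapLambertianEulerArchimedes
  Summit.AtomisticToContinuum.HydrodynamicLimit.Theorems.LambertianContactSwapLambertianEulerLambertLaw
  Summit.AtomisticToContinuum.HydrodynamicLimit.Theorems.LambertianContactSwapLambertianEulerTimeLedgerFresh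
  Summit.AtomisticToContinuum.HydrodynamicLimit.Theorems.LambertianContactSwapLambertianEulerTimeLedgerStopping
  Summit.AtomisticToContinuum.HydrodynamicLimit.Theorems.LambertianContactSwapLambertianEulerFwdGood

/-! ## The time ledger of the velocity moments -/

/-- A measurable real function dominated in absolute value by an integrable one is integrable.
[folklore] -/
theorem integrable_of_abs_le {α : Type*} [MeasurableSpace α] {μ : Measure α} {f g : α → ℝ}
    (h : ∀ a, |f a| ≤ g a) (hf : Measurable f) (hg : Integrable g μ) : Integrable f μ :=
  hg.mono' hf.aestronglyMeasurable
    (Eventually.of_forall fun a => (Real.norm_eq_abs _).trans_le (h a))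

section Ledger

variable {N : ℕ} {G : Geometry (Fin 3) T3} {ε : ℝ}

/-- Twice the kinetic energy is the sum of the squared speeds. [folklore] -/
theorem two_mul_configEnergy (z : Config N (Fin 3) T3) :
    2 * configEnergy z = ∑ i, ‖(z i).2‖ ^ 2 := by
  rw [configEnergy, ← mul_assoc, mul_inv_cancel₀ two_ne_zero, one_mul]

/-- Along the recursion twice the kinetic energy stays below the initial sum of squared speeds
(the kinetic energy never increases, `configEnergy_lambertStateAfter_le`). [folklore] -/
theorem two_mul_configEnergy_stateAfter_le (p : Config N (Fin 3) T3 × (ℕ → V3)) (m : ℕ) :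
    2 * configEnergy (lambertStateAfter G ε p.2 p.1 m) ≤ ∑ i, ‖(p.1 i).2‖ ^ 2 := by
  rw [← two_mul_configEnergy p.1]
  exact mul_le_mul_of_nonneg_left (configEnergy_lambertStateAfter_le p.2 p.1 m) zero_le_two

/-- The `2k`-th moment of every state of the recursion is at most `N (∑ᵢ ‖vᵢ‖²)^k` of the datum.
[folklore] -/
theorem moment_stateAfter_le (p : Config N (Fin 3) T3 × (ℕ → V3)) (m k : ℕ) :
    ∑ i, ‖(lambertStateAfter G ε p.2 p.1 m i).2‖ ^ (2 * k) ≤ N * (∑ i, ‖(p.1 i).2‖ ^ 2) ^ k :=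
  (moment_le_card_mul_pow _ k).trans (mul_le_mul_of_nonneg_left (pow_le_pow_left₀
    (mul_nonneg zero_le_two (configEnergy_nonneg _)) (two_mul_configEnergy_stateAfter_le p m) k)
    (Nat.cast_nonneg _))

/-- The ledger increment of every state of the recursion is at most
`|Fin N × Fin N| (4·2^k/(k+1) + 2) (∑ᵢ ‖vᵢ‖²)^k` of the datum in absolute value
(`abs_increment_le` at the nonincreasing kinetic energy). [folklore] -/
theorem abs_increment_stateAfter_le (p : Config N (Fin 3) T3 × (ℕ → V3)) (m k : ℕ) :
    |(if freeExitTime G ε (lambertStateAfter G ε p.2 p.1 m) = ⊤ then (0 : ℝ)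
      else ∑ q : Fin N × Fin N,
        if incomingPairs G ε (freeFlight G
            (freeExitTime G ε (lambertStateAfter G ε p.2 p.1 m)).toReal
              (lambertStateAfter G ε p.2 p.1 m)) = {q} then
          4 / (k + 1) * (‖(lambertStateAfter G ε p.2 p.1 m q.1).2‖ ^ 2 +
              ‖(lambertStateAfter G ε p.2 p.1 m q.2).2‖ ^ 2) ^ k -
            ‖(lambertStateAfter G ε p.2 p.1 m q.1).2‖ ^ (2 * k) -
            ‖(lambertStateAfter G ε p.2 p.1 m q.2).2‖ ^ (2 * k)
        else 0)| ≤
      Fintype.card (Fin N × Fin N) * (4 / (k + 1) * 2 ^ k + 2) * (∑ i, ‖(p.1 i).2‖ ^ 2) ^ k := by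
  refine (abs_increment_le (two_mul_configEnergy_stateAfter_le p m)).trans_eq ?_
  rw [← two_mul, mul_pow]
  ring

/-- **The time ledger, from almost-sure simplicity and non-accumulation** (general regular
measurable geometry on `𝕋³`, diameter `ε ≠ 0`). If under `P ⊗ γ^ℕ` every exit along the
recursion is a.s. simple incoming when reached and the instants a.s. pass beyond `s'`, and the
collision count up to `s'` weighted by `(∑ᵢ ‖vᵢ‖²)^k` is integrable, then for `s ≤ s'` the
expected `2k`-th moment of `Λ_{s'}` exceeds that of `Λ_s` by at most the expected sum, over the
collisions `m < K_{s'}` with `s < t_{m+1}`, of the guarded pair-Povzner increment at `z_m`.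
Optional stopping `integral_flow_le_of_windowed_ledger` (part II) for the `2k`-th moment and the
ledger increment, whose windowed ledgers on `{s < t_{m+1} ≤ s'}` (events determined by the datum
and the first `m` redraws, `lambertInstant_congr`) come from the weighted transport
`integral_indicator_stateAfter_succ_le` (part I) of the one-step ledger
`integral_moment_lambertStep_le_increment` (pair Povzner bound of the cosine redraw:
`lambertPairPovzner_of_lambertPovzner`, `lambertPovzner_of_archimedes_of_lambertLaw`,
`archimedesV3`, `lambertLaw`), with the envelope `C (∑ᵢ ‖vᵢ‖²)^k` (`moment_stateAfter_le`,
`abs_increment_stateAfter_le`). [folklore] -/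
theorem timeLedger_of_ae (hG : G.IsHardSphereRegular ε) (hGm : G.IsMeasurable) (hε : ε ≠ 0)
    (P : Measure (Config N (Fin 3) T3)) (k : ℕ) {s s' : ℝ} (hss' : s ≤ s')
    (hsimple : ∀ m, ∀ᵐ p ∂(P.prod (lambertNoise (Fin 3))),
      freeExitTime G ε (lambertStateAfter G ε p.2 p.1 m) ≠ ⊤ →
        ∃ q : Fin N × Fin N, incomingPairs G ε (freeFlight G
          (freeExitTime G ε (lambertStateAfter G ε p.2 p.1 m)).toReal
            (lambertStateAfter G ε p.2 p.1 m)) = {q})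
    (hacc : ∀ᵐ p ∂(P.prod (lambertNoise (Fin 3))),
      ∃ n, ENNReal.ofReal s' < lambertInstant G ε p.2 p.1 n)
    (hInt : Integrable (fun p : Config N (Fin 3) T3 × (ℕ → V3) =>
      ((lambertCount G ε p.2 p.1 s' : ℝ) + 1) * (∑ i, ‖(p.1 i).2‖ ^ 2) ^ k)
      (P.prod (lambertNoise (Fin 3)))) :
    ∫ p, (∑ i, ‖(lambertFlow G ε p.2 p.1 s' i).2‖ ^ (2 * k)) ∂(P.prod (lambertNoise (Fin 3))) ≤
      ∫ p, (∑ i, ‖(lambertFlow G ε p.2 p.1 s i).2‖ ^ (2 * k)) ∂(P.prod (lambertNoise (Fin 3))) +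
      ∫ p, (∑ m ∈ Finset.range (lambertCount G ε p.2 p.1 s'),
          if ENNReal.ofReal s < lambertInstant G ε p.2 p.1 (m + 1) then
            (if freeExitTime G ε (lambertStateAfter G ε p.2 p.1 m) = ⊤ then (0 : ℝ)
             else ∑ q : Fin N × Fin N,
              if incomingPairs G ε (freeFlight G
                  (freeExitTime G ε (lambertStateAfter G ε p.2 p.1 m)).toReal
                    (lambertStateAfter G ε p.2 p.1 m)) = {q} then
                4 / (k + 1) * (‖(lambertStateAfter G ε p.2 p.1 m q.1).2‖ ^ 2 +
                    ‖(lambertStateAfter G ε p.2 p.1 m q.2).2‖ ^ 2) ^ k -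
                  ‖(lambertStateAfter G ε p.2 p.1 m q.1).2‖ ^ (2 * k) -
                  ‖(lambertStateAfter G ε p.2 p.1 m q.2).2‖ ^ (2 * k)
              else 0)
          else 0) ∂(P.prod (lambertNoise (Fin 3))) := by
  -- the pair Povzner bound of the cosine redraw (proved on the line)
  have hPP := lambertPairPovzner_of_lambertPovzner
    (lambertPovzner_of_archimedes_of_lambertLaw archimedesV3 lambertLaw)
  -- the envelope `C (∑ᵢ ‖vᵢ‖²)^k`
  set C : ℝ := N + Fintype.card (Fin N × Fin N) * (4 / (k + 1) * 2 ^ k + 2) with hC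
  have hC1 : (N : ℝ) ≤ C := by rw [hC]; exact le_add_of_nonneg_right (by positivity)
  have hC2 : Fintype.card (Fin N × Fin N) * (4 / (k + 1) * 2 ^ k + 2) ≤ C := by
    rw [hC]; exact le_add_of_nonneg_left (Nat.cast_nonneg _)
  have hE0m : Measurable fun p : Config N (Fin 3) T3 × (ℕ → V3) => (∑ i, ‖(p.1 i).2‖ ^ 2) ^ k :=
    (Finset.measurable_sum _ fun i _ =>
      ((measurable_pi_apply i).comp measurable_fst).snd.norm.pow_const 2).pow_const k
  have hMB : ∀ (m : ℕ) (p : Config N (Fin 3) T3 × (ℕ → V3)),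
      ∑ i, ‖(lambertStateAfter G ε p.2 p.1 m i).2‖ ^ (2 * k) ≤ C * (∑ i, ‖(p.1 i).2‖ ^ 2) ^ k :=
    fun m p => (moment_stateAfter_le p m k).trans (mul_le_mul_of_nonneg_right hC1 (by positivity))
  have hIB := fun (m : ℕ) (p : Config N (Fin 3) T3 × (ℕ → V3)) =>
    (abs_increment_stateAfter_le (G := G) (ε := ε) p m k).trans
      (mul_le_mul_of_nonneg_right hC2 (by positivity))
  have hIntC : Integrable (fun p : Config N (Fin 3) T3 × (ℕ → V3) =>
      ((lambertCount G ε p.2 p.1 s' : ℝ) + 1) * (C * (∑ i, ‖(p.1 i).2‖ ^ 2) ^ k))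
      (P.prod (lambertNoise (Fin 3))) := by
    simpa only [mul_left_comm _ C, ← mul_assoc C] using hInt.const_mul C
  refine integral_flow_le_of_windowed_ledger hG hGm P (measurable_moment k)
    (measurable_increment hG hGm k) (fun w => by positivity)
    (fun t w => by simp only [freeFlight_apply]) (measurable_const.mul hE0m) hMB hIB hss' hIntC
    (fun m => ?_) hacc
  -- the windowed ledger at index `m`, from part I
  have hT : Measurable fun p : Config N (Fin 3) T3 × (ℕ → V3) =>
      lambertInstant G ε p.2 p.1 (m + 1) := measurable_lambertInstant hG hGm (m + 1)
  have hZ : Measurable fun p : Config N (Fin 3) T3 × (ℕ → V3) =>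
      lambertStateAfter G ε p.2 p.1 m := measurable_lambertStateAfter hG hGm m
  have hA : MeasurableSet {p : Config N (Fin 3) T3 × (ℕ → V3) |
      ENNReal.ofReal s < lambertInstant G ε p.2 p.1 (m + 1) ∧
        lambertInstant G ε p.2 p.1 (m + 1) ≤ ENNReal.ofReal s'} :=
    (measurableSet_lt measurable_const hT).inter (measurableSet_le hT measurable_const)
  -- integrability of the envelope and of `1_A (M(z_m) + I(z_m))`
  have hE : Integrable (fun p : Config N (Fin 3) T3 × (ℕ → V3) => C * (∑ i, ‖(p.1 i).2‖ ^ 2) ^ k)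
      (P.prod (lambertNoise (Fin 3))) := by
    refine hIntC.mono' (measurable_const.mul hE0m).aestronglyMeasurable
      (Eventually.of_forall fun p => ?_)
    have h0 : 0 ≤ C * (∑ i, ‖(p.1 i).2‖ ^ 2) ^ k := le_trans (by positivity) (hMB 0 p)
    rw [Real.norm_of_nonneg h0]
    exact le_mul_of_one_le_left h0 (le_add_of_nonneg_left (Nat.cast_nonneg _))
  refine integral_indicator_stateAfter_succ_le hG hGm (measurable_moment k)
    (I := fun w => if freeExitTime G ε w = ⊤ then (0 : ℝ) else ∑ q : Fin N × Fin N,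
      if incomingPairs G ε (freeFlight G (freeExitTime G ε w).toReal w) = {q} then
        4 / (k + 1) * (‖(w q.1).2‖ ^ 2 + ‖(w q.2).2‖ ^ 2) ^ k
          - ‖(w q.1).2‖ ^ (2 * k) - ‖(w q.2).2‖ ^ (2 * k)
      else 0)
    (fun w => by positivity) m P hA (fun p => ?_) ?_ ?_
  · have h : lambertInstant G ε (fun i => if i < m then p.2 i else 0) p.1 (m + 1) =
        lambertInstant G ε p.2 p.1 (m + 1) :=
      lambertInstant_congr (fun i hi => if_pos hi) le_rfl
    simp only [Set.mem_setOf_eq, h]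
  · have hintM : Integrable (fun p : Config N (Fin 3) T3 × (ℕ → V3) =>
        ∑ i, ‖(lambertStateAfter G ε p.2 p.1 m i).2‖ ^ (2 * k)) (P.prod (lambertNoise (Fin 3))) :=
      integrable_of_abs_le (fun p => (abs_of_nonneg (by positivity)).trans_le (hMB m p))
        ((measurable_moment k).comp hZ) hE
    exact (hintM.add (integrable_of_abs_le (hIB m) ((measurable_increment hG hGm k).comp hZ)
      hE)).indicator hA
  · filter_upwards [hsimple m] with p hp
    exact ⟨integrable_moment_lambertStep G ε k _,
      integral_moment_lambertStep_le_increment hPP G hε k hp⟩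

end Ledger

/-! ## The registered sub-goal `timeLedgerLambda` -/

/-- **The time ledger (T) of the tails memo, from the a.e. forward regularity of `Λ`**: the
registered statement `timeLedgerLambda` with the conclusion of `lambert_ae_fwdGood` (simple
incoming exits, no grazing, unbounded instants, `liouville ⊗ γ^ℕ`-a.e.) as an explicit hypothesis;
`P ⊗ γ^ℕ ≪ liouville ⊗ γ^ℕ` (`Measure.AbsolutelyContinuous.prod`) transfers the a.e. simplicity
(`IsSimpleIncomingWith.incomingPairs_eq`) and non-accumulation to `P ⊗ γ^ℕ`, and
`timeLedger_of_ae` applies on the torus geometry (regular and measurable for `ε < 1/2`).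
[folklore] -/
theorem timeLedgerLambda_of_fwdGood {ε : ℝ} (hε : 0 < ε) (hε' : ε < 2⁻¹) {N : ℕ}
    (hgood : ∀ᵐ p ∂((liouville (Torus.geometry (Fin 3)) N ε).prod (lambertNoise (Fin 3))),
        (∀ k, freeExitTime (Torus.geometry (Fin 3)) ε
            (lambertStateAfter (Torus.geometry (Fin 3)) ε p.2 p.1 k) ≠ ⊤ →
          IsSimpleIncoming (Torus.geometry (Fin 3)) ε
            (freeFlight (Torus.geometry (Fin 3))
              (freeExitTime (Torus.geometry (Fin 3)) ε
                (lambertStateAfter (Torus.geometry (Fin 3)) ε p.2 p.1 k)).toReal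
              (lambertStateAfter (Torus.geometry (Fin 3)) ε p.2 p.1 k))) ∧
        (∀ k (s : ℝ), 0 < s →
          ENNReal.ofReal s < freeExitTime (Torus.geometry (Fin 3)) ε
            (lambertStateAfter (Torus.geometry (Fin 3)) ε p.2 p.1 k) →
          ∀ i j : Fin N, i ≠ j →
            freeFlight (Torus.geometry (Fin 3)) s
                (lambertStateAfter (Torus.geometry (Fin 3)) ε p.2 p.1 k) ∉
              contactSet (Torus.geometry (Fin 3)) N ε i j) ∧
        (∀ T : ℝ, ∃ k, ENNReal.ofReal T < lambertInstant (Torus.geometry (Fin 3)) ε p.2 p.1 k))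
    (P : Measure (Config N (Fin 3) T3)) (hP : P ≪ liouville (Torus.geometry (Fin 3)) N ε)
    (k : ℕ) {s s' : ℝ} (hss' : s ≤ s')
    (hInt : Integrable (fun p : Config N (Fin 3) T3 × (ℕ → V3) =>
        ((lambertCount (Torus.geometry (Fin 3)) ε p.2 p.1 s' : ℝ) + 1) * (∑ i, ‖(p.1 i).2‖ ^ 2) ^ k)
        (P.prod (lambertNoise (Fin 3)))) :
    ∫ p, (∑ i, ‖(lambertFlow (Torus.geometry (Fin 3)) ε p.2 p.1 s' i).2‖ ^ (2 * k))
        ∂(P.prod (lambertNoise (Fin 3))) ≤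
      ∫ p, (∑ i, ‖(lambertFlow (Torus.geometry (Fin 3)) ε p.2 p.1 s i).2‖ ^ (2 * k))
        ∂(P.prod (lambertNoise (Fin 3))) +
      ∫ p, (∑ m ∈ Finset.range (lambertCount (Torus.geometry (Fin 3)) ε p.2 p.1 s'),
          if ENNReal.ofReal s < lambertInstant (Torus.geometry (Fin 3)) ε p.2 p.1 (m + 1) then
            (if freeExitTime (Torus.geometry (Fin 3)) ε
                (lambertStateAfter (Torus.geometry (Fin 3)) ε p.2 p.1 m) = ⊤ then (0 : ℝ)
             else ∑ q : Fin N × Fin N,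
              if incomingPairs (Torus.geometry (Fin 3)) ε
                  (freeFlight (Torus.geometry (Fin 3))
                    (freeExitTime (Torus.geometry (Fin 3)) ε
                      (lambertStateAfter (Torus.geometry (Fin 3)) ε p.2 p.1 m)).toReal
                    (lambertStateAfter (Torus.geometry (Fin 3)) ε p.2 p.1 m)) = {q} then
                4 / (k + 1) *
                    (‖(lambertStateAfter (Torus.geometry (Fin 3)) ε p.2 p.1 m q.1).2‖ ^ 2 +
                      ‖(lambertStateAfter (Torus.geometry (Fin 3)) ε p.2 p.1 m q.2).2‖ ^ 2) ^ k -
                  ‖(lambertStateAfter (Torus.geometry (Fin 3)) ε p.2 p.1 m q.1).2‖ ^ (2 * k) -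
                  ‖(lambertStateAfter (Torus.geometry (Fin 3)) ε p.2 p.1 m q.2).2‖ ^ (2 * k)
              else 0)
          else 0) ∂(P.prod (lambertNoise (Fin 3))) := by
  have hG : (Torus.geometry (Fin 3)).IsHardSphereRegular ε := Torus.isHardSphereRegular_geometry hε'
  have hGm : (Torus.geometry (Fin 3)).IsMeasurable := Torus.isMeasurable_geometry
  have hac : P.prod (lambertNoise (Fin 3)) ≪
      (liouville (Torus.geometry (Fin 3)) N ε).prod (lambertNoise (Fin 3)) :=
    hP.prod Measure.AbsolutelyContinuous.rfl
  have hgood' := hac.ae_le hgood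
  refine timeLedger_of_ae hG hGm hε.ne' P k hss' (fun m => ?_) ?_ hInt
  · filter_upwards [hgood'] with p hp hτ
    obtain ⟨q, hq⟩ := isSimpleIncoming_iff.1 (hp.1 m hτ)
    exact ⟨q, hq.incomingPairs_eq⟩
  · filter_upwards [hgood'] with p hp
    exact hp.2.2 s'


/-- **The time ledger (T) of the tails memo** (registered sub-goal `timeLedgerLambda` of
`stub_tailsLambda`, line `Sketch` of the crux `LambertianEuler`): for `0 < ε < 1/2`, an initial
probability law `P ≪ liouville` on `𝕋³`, `k`, times `0 ≤ s ≤ s'`, and under the integrability of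
`(K_{s'} + 1) (∑ᵢ ‖vᵢ‖²)^k` under `P ⊗ γ^ℕ` (the hypothesis that makes the optional-stopping
exchange legitimate), the expected `2k`-th velocity moment of `Λ_{s'}` is at most that of `Λ_s`
plus the expected sum, over the collisions `m < K_{s'}` with `s < t_{m+1}`, of the guarded
pair-Povzner increment `1_{τ(z_m)<∞} ((4/(k+1)) (‖vᵢ‖² + ‖vⱼ‖²)^k − ‖vᵢ‖^{2k} − ‖vⱼ‖^{2k})(z_m)`,
`(i, j)` the colliding pair of `z_m` (`timeLedgerLambda_of_fwdGood` and `lambert_ae_fwdGood`).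
[folklore] -/
theorem timeLedgerLambda :
    ∀ {ε : ℝ}, 0 < ε → ε < 2⁻¹ → ∀ {N : ℕ} (P : Measure (Config N (Fin 3) T3)) [IsProbabilityMeasure P],
      P ≪ liouville (Torus.geometry (Fin 3)) N ε →
      ∀ (k : ℕ) (s s' : ℝ), 0 ≤ s → s ≤ s' →
      Integrable (fun p : Config N (Fin 3) T3 × (ℕ → V3) =>
        ((lambertCount (Torus.geometry (Fin 3)) ε p.2 p.1 s' : ℝ) + 1) * (∑ i, ‖(p.1 i).2‖ ^ 2) ^ k)
        (P.prod (lambertNoise (Fin 3))) →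
        ∫ p, (∑ i, ‖(lambertFlow (Torus.geometry (Fin 3)) ε p.2 p.1 s' i).2‖ ^ (2 * k))
            ∂(P.prod (lambertNoise (Fin 3))) ≤
          ∫ p, (∑ i, ‖(lambertFlow (Torus.geometry (Fin 3)) ε p.2 p.1 s i).2‖ ^ (2 * k))
            ∂(P.prod (lambertNoise (Fin 3))) +
          ∫ p, (∑ m ∈ Finset.range (lambertCount (Torus.geometry (Fin 3)) ε p.2 p.1 s'),
              if ENNReal.ofReal s < lambertInstant (Torus.geometry (Fin 3)) ε p.2 p.1 (m + 1) then
                (if freeExitTime (Torus.geometry (Fin 3)) ε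
                    (lambertStateAfter (Torus.geometry (Fin 3)) ε p.2 p.1 m) = ⊤ then (0 : ℝ)
                 else ∑ q : Fin N × Fin N,
                  if incomingPairs (Torus.geometry (Fin 3)) ε
                      (freeFlight (Torus.geometry (Fin 3))
                        (freeExitTime (Torus.geometry (Fin 3)) ε
                          (lambertStateAfter (Torus.geometry (Fin 3)) ε p.2 p.1 m)).toReal
                        (lambertStateAfter (Torus.geometry (Fin 3)) ε p.2 p.1 m)) = {q} then
                    4 / (k + 1) * (‖(lambertStateAfter (Torus.geometry (Fin 3)) ε p.2 p.1 m q.1).2‖ ^ 2 +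
                        ‖(lambertStateAfter (Torus.geometry (Fin 3)) ε p.2 p.1 m q.2).2‖ ^ 2) ^ k -
                      ‖(lambertStateAfter (Torus.geometry (Fin 3)) ε p.2 p.1 m q.1).2‖ ^ (2 * k) -
                      ‖(lambertStateAfter (Torus.geometry (Fin 3)) ε p.2 p.1 m q.2).2‖ ^ (2 * k)
                  else 0)
              else 0) ∂(P.prod (lambertNoise (Fin 3))) := by
  intro ε hε hε' N P _ hP k s s' _ hss' hInt
  exact timeLedgerLambda_of_fwdGood hε hε' (lambert_ae_fwdGood hε hε') P hP k hss' hInt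

end Summit.AtomisticToContinuum.HydrodynamicLimit.Theorems.LambertianContactSwapLambertianEulerTimeLedger

end
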